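import Mathlib
import Summits.Ventures.PercRepro2.Graph
import Summits.Ventures.PercRepro2.Exploration
import Summits.Ventures.PercRepro2.Harris
import Summits.Ventures.PercRepro2.GibbsPAJoint
import Summits.Ventures.PercRepro2.SepClusterJoint
import Summits.Ventures.PercRepro2.SepClusterSupport
import Summits.Ventures.PercRepro2.SepClusterHarris
import Summits.Ventures.PercRepro2.SepFamJoint
import Summits.Ventures.PercRepro2.SepFamSupport
import Summits.Ventures.PercRepro2.SepFamHarris

/-!
# The separated clusters of a family of roots are positively associated (blind cell PercRepro2,
p3 g12, 2026-08-27; `proofs/P3-G2.md` Theorem A for root SETS `X`, `Y`)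

Conditioned on `{X ↮ Y}` (disjoint finite families of roots), the TUPLE of clusters
`(C(y))_{y ∈ Y}` is positively associated for the coordinatewise order: for monotone
`g₁, g₂ : (Y → Set V) → ℝ`,
  `E[1_S · g₁(expl Y)] · E[1_S · g₂(expl Y)] ≤ P(S) · E[1_S · g₁(expl Y) g₂(expl Y)]`
(`sep_fam_pa`), edge weights strictly inside `(0, 1)`.  The minorisation is by the minimal
`X`-tuple `x ↦ {x}` (`minorisation_fam`).  Own work; standard axioms.
-/

namespace Summit.Ventures.PercRepro2

namespace SepPA

open Finset Classical

section FamilyPA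

variable {V : Type*} {E : Type*} [Fintype V] [Fintype E] [DecidableEq E]
variable (ends : E → Sym2 V) (p : E → ℝ) (X Y : Finset V)

/-- The minimal `X`-tuple: every root alone. -/
def minTuple : X → Set V := fun x => {(x : V)}

/-- The edges at the roots of `X`, as a `Finset`. -/
noncomputable def starFam : Finset E := Finset.univ.filter (fun e => e ∈ touches ends (X : Set V))

variable {X Y}

omit [Fintype V] [Fintype E] [DecidableEq E] in
/-- The footprint of the minimal tuple is `X`. -/
lemma foot_minTuple : foot (minTuple X) = (X : Set V) := by
  ext v
  simp only [foot, minTuple, Set.mem_setOf_eq, Set.mem_singleton_iff, Finset.mem_coe]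
  constructor
  · rintro ⟨x, hx⟩; rw [hx]; exact x.2
  · intro hv; exact ⟨⟨v, hv⟩, rfl⟩

omit [Fintype V] [DecidableEq E] in
/-- If every edge at `X` is closed, every root of `X` explored away from anything is alone. -/
lemma explAway_eq_minTuple_of_allClosed (F : Set V) {ω : Config E}
    (h : ω ∈ allClosed (starFam ends X)) : explAway ends X F ω = minTuple X := by
  funext x
  unfold explAway clAway minTuple
  apply cluster_eq_singleton_of_closed
  intro e he
  have hωe : ω e = false := by
    apply h e
    simp only [starFam, Finset.mem_filter, Finset.mem_univ, true_and]
    exact touches_mono ends (fun v hv => by rw [Set.mem_singleton_iff.mp hv]; exact x.2) he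
  cases hr : restrict (touches ends F)ᶜ ω e
  · rfl
  · exfalso
    have := (restrict_eq_true_iff.mp hr).1
    rw [hωe] at this
    exact Bool.false_ne_true this

omit [Fintype V] in
/-- `P(expl X of G − F = minTuple) ≥ ∏_{e at X} (1 − p e)`. -/
lemma prod_le_prob_explAway_minTuple (hp01 : ∀ e, 0 < p e ∧ p e < 1) (F : Set V) :
    ∏ e ∈ starFam ends X, (1 - p e) ≤ prob p {ω | explAway ends X F ω = minTuple X} := by
  rw [← prob_allClosed]
  apply prob_mono (isProbVec_of_interior p hp01)
  intro ω hω
  exact explAway_eq_minTuple_of_allClosed ends F hω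

omit [Fintype V] [Fintype E] [DecidableEq E] in
/-- On `{expl Y = t} ∩ S`, removing the edges at `X` does not change the clusters of `Y`. -/
lemma explAway_coe_eq_of_mem {t : Y → Set V} {ω : Config E}
    (hω : ω ∈ explEvent ends Y t ∩ sepFam ends X Y) : explAway ends Y (X : Set V) ω = t := by
  funext y
  unfold explAway clAway
  apply cluster_eq_of_eqOn_touches _ (hω.1 y)
  intro e he
  by_cases hex : e ∈ touches ends (X : Set V)
  · have hnot : e ∉ (touches ends (X : Set V))ᶜ := by simpa using hex
    rw [restrict_apply_of_notMem hnot]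
    obtain ⟨a, ha, b, hab⟩ := hex
    obtain ⟨a', ha', b', hab'⟩ := he
    cases h : ω e
    · rfl
    · exfalso
      -- an open edge with one end in `C(y) = t y` has its other end in it
      have hadj : ∀ u v : V, ends e = s(u, v) → u ∈ t y → v ∈ t y := by
        intro u v huv hu
        have hmem : u ∈ cluster ends ω y := by rw [hω.1 y]; exact hu
        have hv : v ∈ cluster ends ω y := by
          by_cases huv' : u = v
          · rw [← huv']; exact hmem
          · exact mem_cluster_of_adj hmem (openGraph_adj.2 ⟨huv', e, h, huv⟩)
        rw [hω.1 y] at hv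
        exact hv
      -- `a ∈ X` would then lie in `C(y)`, contradicting the separation
      have hsep : a ∉ t y := by
        intro hat
        apply hω.2 a (Finset.mem_coe.mp ha) y y.2
        rw [← hω.1 y] at hat
        exact conn_symm hat
      rw [hab, Sym2.eq_iff] at hab'
      rcases hab' with ⟨h1, _⟩ | ⟨h1, h2⟩
      · exact hsep (by rw [h1]; exact ha')
      · have hb : b ∈ t y := by rw [h2]; exact ha'
        exact hsep (hadj b a (by rw [hab, Sym2.eq_swap]) hb)
  · have hmem : e ∈ (touches ends (X : Set V))ᶜ := hex
    rw [restrict_apply_of_mem hmem]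

omit [Fintype V] in
/-- `P(expl Y = t', S) ≤ P(expl Y of G − X = t')`. -/
lemma prob_le_prob_explAway_coe (hp01 : ∀ e, 0 < p e ∧ p e < 1) (t' : Y → Set V) :
    prob p (explEvent ends Y t' ∩ sepFam ends X Y) ≤
      prob p {ω | explAway ends Y (X : Set V) ω = t'} := by
  apply prob_mono (isProbVec_of_interior p hp01)
  intro ω hω
  exact explAway_coe_eq_of_mem ends hω

omit [Fintype V] [Fintype E] [DecidableEq E] in
/-- The all-closed configuration explores the minimal tuple. -/
lemma allFalse_mem_explEvent_minTuple :
    (fun _ => false : Config E) ∈ explEvent ends X (minTuple X) :=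
  fun _ => cluster_eq_singleton_of_closed (fun _ _ => rfl)

/-- **Minorisation** by the minimal `X`-tuple. -/
theorem minorisation_fam (hp01 : ∀ e, 0 < p e ∧ p e < 1) (hXY : Disjoint X Y)
    (t t' : Y → Set V) (ht : (∑ k, Jf ends p X Y t k) ≠ 0) :
    (∏ e ∈ starFam ends X, (1 - p e)) * prob p (sepFam ends X Y) * (∑ k, Jf ends p X Y t' k) ≤
      GibbsPAJoint.gibbsKernel (Jf ends p X Y) t t' := by
  have hJ0 : ∀ t k, 0 ≤ Jf ends p X Y t k := Jf_nonneg ends p hp01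
  have hS : prob p (sepFam ends X Y) ≠ 0 := ne_of_gt (prob_sepFam_pos ends p hp01 hXY)
  have hS0 : 0 ≤ prob p (sepFam ends X Y) := le_of_lt (prob_sepFam_pos ends p hp01 hXY)
  have hterm : (Jf ends p X Y t (minTuple X) / ∑ k, Jf ends p X Y t k) *
      (Jf ends p X Y t' (minTuple X) / ∑ t'', Jf ends p X Y t'' (minTuple X)) ≤
      GibbsPAJoint.gibbsKernel (Jf ends p X Y) t t' := by
    unfold GibbsPAJoint.gibbsKernel
    apply Finset.single_le_sum (f := fun k => (Jf ends p X Y t k / ∑ k', Jf ends p X Y t k') *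
      (Jf ends p X Y t' k / ∑ s'', Jf ends p X Y s'' k)) _ (Finset.mem_univ (minTuple X))
    intro k _
    apply mul_nonneg
    · exact div_nonneg (hJ0 t k) (Finset.sum_nonneg (fun k' _ => hJ0 t k'))
    · exact div_nonneg (hJ0 t' k) (Finset.sum_nonneg (fun t'' _ => hJ0 t'' k))
  -- (i) the first factor is `P(expl X of G − foot t = minTuple)`
  obtain ⟨ω₀, hω₀⟩ := exists_mem_of_sum_Jf_right_ne_zero ends p ht
  have hX : ∀ x ∈ X, x ∉ foot t := fun x hx => not_mem_foot_of_sepFam hω₀.1 hω₀.2 hx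
  have hsub : explEvent ends Y t ∩ sepFam ends X Y = explEvent ends Y t :=
    Set.inter_eq_left.mpr (fun ω hω => mem_sepFam_of_explEvent hω hX)
  have hpos : prob p (explEvent ends Y t) ≠ 0 := by
    rw [← hsub]; exact ne_of_gt (prob_pos_of_mem p hp01 hω₀)
  have hset1 : {ω | ∀ x : X, clAway ends (foot t) x ω = minTuple X x} =
      {ω | explAway ends X (foot t) ω = minTuple X} := by
    ext ω
    simp only [Set.mem_setOf_eq]
    constructor
    · intro h; funext x; exact h x
    · intro h x; exact congrFun h x
  have e1 : Jf ends p X Y t (minTuple X) / ∑ k, Jf ends p X Y t k =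
      prob p {ω | explAway ends X (foot t) ω = minTuple X} := by
    rw [sum_Jf_right, hsub]
    unfold Jf
    rw [prob_joint_fam ends p X Y hX (minTuple X), hset1]
    field_simp
  -- (ii) the second factor is `P(expl Y of G − X = t')`
  have hY : ∀ y ∈ Y, y ∉ foot (minTuple X) := by
    intro y hy
    rw [foot_minTuple]
    exact fun hyX => Finset.disjoint_left.mp hXY (Finset.mem_coe.mp hyX) hy
  have hsub' : explEvent ends X (minTuple X) ∩ sepFam ends X Y = explEvent ends X (minTuple X) := by
    apply Set.inter_eq_left.mpr
    intro ω hω x hx y hy h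
    apply hY y hy
    refine ⟨⟨x, hx⟩, ?_⟩
    rw [← hω ⟨x, hx⟩]
    exact h
  have hpos' : prob p (explEvent ends X (minTuple X)) ≠ 0 :=
    ne_of_gt (prob_pos_of_mem p hp01 (allFalse_mem_explEvent_minTuple ends))
  have hset2 : {ω | ∀ y : Y, clAway ends (foot (minTuple X)) y ω = t' y} =
      {ω | explAway ends Y (X : Set V) ω = t'} := by
    ext ω
    simp only [Set.mem_setOf_eq, foot_minTuple]
    constructor
    · intro h; funext y; exact h y
    · intro h y; exact congrFun h y
  have e2 : Jf ends p X Y t' (minTuple X) / ∑ t'', Jf ends p X Y t'' (minTuple X) =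
      prob p {ω | explAway ends Y (X : Set V) ω = t'} := by
    rw [sum_Jf_left, hsub']
    unfold Jf
    rw [prob_joint_fam' ends p X Y hY t', hset2]
    field_simp
  rw [e1, e2] at hterm
  have b1 := prod_le_prob_explAway_minTuple ends p (X := X) hp01 (foot t)
  have b2 := prob_le_prob_explAway_coe ends p (X := X) (Y := Y) hp01 t'
  have hq' : prob p (explEvent ends Y t' ∩ sepFam ends X Y) =
      (∑ k, Jf ends p X Y t' k) * prob p (sepFam ends X Y) := by
    rw [sum_Jf_right]
    field_simp
  rw [hq'] at b2
  have hc0 : 0 ≤ ∏ e ∈ starFam ends X, (1 - p e) :=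
    Finset.prod_nonneg (fun e _ => by linarith [(hp01 e).2])
  have hq0 : 0 ≤ ∑ k, Jf ends p X Y t' k := Finset.sum_nonneg (fun k _ => hJ0 t' k)
  calc (∏ e ∈ starFam ends X, (1 - p e)) * prob p (sepFam ends X Y) * (∑ k, Jf ends p X Y t' k)
      = (∏ e ∈ starFam ends X, (1 - p e)) *
          ((∑ k, Jf ends p X Y t' k) * prob p (sepFam ends X Y)) := by ring
    _ ≤ prob p {ω | explAway ends X (foot t) ω = minTuple X} *
          prob p {ω | explAway ends Y (X : Set V) ω = t'} :=
        mul_le_mul b1 b2 (mul_nonneg hq0 hS0) (prob_nonneg (isProbVec_of_interior p hp01) _)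
    _ ≤ _ := hterm

/-! ### Assembly -/

/-- Monotone functions of tuples are monotone on the support. -/
lemma incYf_of_monotone {g : (Y → Set V) → ℝ} (hg : Monotone g) : IncYf ends p X Y g :=
  fun _ _ _ _ h => hg h

/-- The family joint law sums to `1`. -/
lemma sum_sum_Jf (hp01 : ∀ e, 0 < p e ∧ p e < 1) (hXY : Disjoint X Y) :
    ∑ t, ∑ k, Jf ends p X Y t k = 1 := by
  have hS : prob p (sepFam ends X Y) ≠ 0 := ne_of_gt (prob_sepFam_pos ends p hp01 hXY)
  simp_rw [sum_Jf_right]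
  rw [← Finset.sum_div]
  have : ∑ t : Y → Set V, prob p (explEvent ends Y t ∩ sepFam ends X Y) =
      prob p (sepFam ends X Y) := by
    rw [prob_eq_sum_prob_inter p (sepFam ends X Y) (fun ω => expl ends ω Y)]
    apply Finset.sum_congr rfl
    intro t _
    rw [Set.inter_comm, ← explEvent_eq_preimage]
  rw [this, div_self hS]

/-- The expectation of `1_S · g(expl Y)` through the `Y`-marginal. -/
lemma expect_indicator_expl (hp01 : ∀ e, 0 < p e ∧ p e < 1) (hXY : Disjoint X Y)
    (g : (Y → Set V) → ℝ) :
    expect p (fun ω => (sepFam ends X Y).indicator (fun _ => (1 : ℝ)) ω * g (expl ends ω Y))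
      = prob p (sepFam ends X Y) * ∑ t, (∑ k, Jf ends p X Y t k) * g t := by
  have hS : prob p (sepFam ends X Y) ≠ 0 := ne_of_gt (prob_sepFam_pos ends p hp01 hXY)
  rw [expect_indicator_comp_eq_sum p (sepFam ends X Y) (fun ω => expl ends ω Y) g,
    Finset.mul_sum]
  apply Finset.sum_congr rfl
  intro t _
  rw [sum_Jf_right, Set.inter_comm, ← explEvent_eq_preimage]
  field_simp

/-- **The core of Theorem A (root sets)**: two functions of the `Y`-tuple monotone on the
support have non-negative covariance under `P(· | X ↮ Y)`. -/
theorem cov_nonneg_incYf (hp01 : ∀ e, 0 < p e ∧ p e < 1) (hXY : Disjoint X Y)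
    (g₁ g₂ : (Y → Set V) → ℝ) (h₁ : IncYf ends p X Y g₁) (h₂ : IncYf ends p X Y g₂) :
    0 ≤ GibbsPAq.cov (fun t => ∑ k, Jf ends p X Y t k) g₁ g₂ := by
  have hδ : 0 < (∏ e ∈ starFam ends X, (1 - p e)) * prob p (sepFam ends X Y) :=
    mul_pos (Finset.prod_pos (fun e _ => by linarith [(hp01 e).2]))
      (prob_sepFam_pos ends p hp01 hXY)
  exact GibbsPAJoint.cov_nonneg_of_joint (Jf ends p X Y) (Jf_nonneg ends p hp01)
    (sum_sum_Jf ends p hp01 hXY) (IncYf ends p X Y) (AntiXf ends p X Y)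
    (fun g hg => antiXf_condS ends p hp01 hXY hg)
    (fun F hF => incYf_condS_transpose ends p hp01 hXY hF)
    (fun g₁ g₂ hg₁ hg₂ k => harris_right_fam ends p hp01 hXY g₁ g₂ hg₁ hg₂ k)
    (fun F₁ F₂ hF₁ hF₂ t => harris_left_fam ends p hp01 hXY F₁ F₂ hF₁ hF₂ t)
    _ hδ (fun t t' ht => minorisation_fam ends p hp01 hXY t t' ht) g₁ g₂ h₁ h₂

/-- **The separated clusters of a family of roots are positively associated (Theorem A of
`P3-G2.md`).**  For disjoint `X, Y`, weights in `(0,1)`, and monotone `g₁ g₂ : (Y → Set V) → ℝ`: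
`E[1_S g₁(expl Y)] · E[1_S g₂(expl Y)] ≤ P(S) · E[1_S g₁(expl Y) g₂(expl Y)]`, `S = {X ↮ Y}`. -/
theorem sep_fam_pa (hp01 : ∀ e, 0 < p e ∧ p e < 1) (hXY : Disjoint X Y)
    (g₁ g₂ : (Y → Set V) → ℝ) (h₁ : Monotone g₁) (h₂ : Monotone g₂) :
    expect p (fun ω => (sepFam ends X Y).indicator (fun _ => (1 : ℝ)) ω * g₁ (expl ends ω Y)) *
      expect p (fun ω => (sepFam ends X Y).indicator (fun _ => (1 : ℝ)) ω * g₂ (expl ends ω Y)) ≤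
    prob p (sepFam ends X Y) *
      expect p (fun ω => (sepFam ends X Y).indicator (fun _ => (1 : ℝ)) ω *
        (g₁ (expl ends ω Y) * g₂ (expl ends ω Y))) := by
  have hcov := cov_nonneg_incYf ends p hp01 hXY g₁ g₂ (incYf_of_monotone ends p h₁)
    (incYf_of_monotone ends p h₂)
  unfold GibbsPAq.cov at hcov
  rw [expect_indicator_expl ends p hp01 hXY g₁, expect_indicator_expl ends p hp01 hXY g₂,
    expect_indicator_expl ends p hp01 hXY (fun t => g₁ t * g₂ t)]
  have hS0 : 0 ≤ prob p (sepFam ends X Y) := le_of_lt (prob_sepFam_pos ends p hp01 hXY)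
  have := mul_le_mul_of_nonneg_left hcov (mul_nonneg hS0 hS0)
  nlinarith [this]

end FamilyPA

end SepPA

end Summit.Ventures.PercRepro2
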